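import Summits.BirchSwinnertonDyer.BirchSwinnertonDyer.Theorems.PrintCf2RamifiedOffTYZMoverCoordinates
import Summits.BirchSwinnertonDyer.BirchSwinnertonDyer.Theorems.PrintCf2RamifiedOffTYZMoverKerCount
import HarnessLib

/-!
# Crux `PrintCf2.RamifiedOffTYZOfFacts` (stmt-BirchSwinnertonDyer-20509), line `offtyz-v7`, LEAD cycle 8 (cruxlead-20509 g7):
# THE BLOCK FORM — the motion of the genus period `Z(d)` under a SQUARED Galois element is the linear form `ρ(N_d)·x` of the
# genus-field coordinates, `ρ(N_d)` the kernel sum of the REAL Rédei matrix `N_d = A_d + D₋₁`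

THEOREMS ONLY (no `def`, no named fact, no `sorry`), `--supports stmt-BirchSwinnertonDyer-20509`.

SETTING.  `D : GenusPointData n`, `n` square-free, a displayed block `d = q₁⋯q_m ≡ 5 (mod 8)` (`q` distinct odd primes, `CMBlockSpec`,
the ring class dictionary `RingClassTwoBlockSpec ρ_d`), and the FROBENIUS HYPOTHESIS of the block (a printed sentence, taken here as an
explicit hypothesis `hFrob` pending its display in `Literature/…/TianYuanZhang2017`): for every `q_j` there is `φ_j ∈ Gal(ℍ′_n/K_d)` with
`φ_j² ∈ Gal(ℍ′_n/H′_d)` (the Frobenius of the ramified prime `𝔭_{q_j}` in the ring class field `H′_d = H_{d,𝒪₂}` is the Artin symbol of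
`[𝔭_{q_j}]`, an involution of `Pic(𝒪₂)`: `𝔭_{q_j}² = (q_j)`), acting on `i` and on `√−q_i` (`i ≠ j`) by Euler's criterion: `φ_j(i) = (−1/q_j)·i`,
`φ_j(√−q_i) = (−q_i/q_j)·√−q_i`.
RESULT (`sqMotion_eq_kerSum_dotProduct_bits`): for every `g ∈ Gal(ℍ′_n/K_d)`,
  **`[(g*g)^{g(d)}·σ_d⁻¹ ∈ Gal(ℍ′_n/H′_d)] = Σ_i ρ(N_d)_i · [g moves i√−q_i]`**,
i.e. (with `…MoverSquares`) `g*g·Z(d) = Z(d) + (ρ(N_d)·x_d(g))·τ(1)`, where `ρ(N_d) = kerSum N_d` (`QForm.kerSum`; g5's `blockRho`).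
PROOF.  `χ(g) := [ρ_d(g)^{2g(d)} = κ]` is a character of `Gal(ℍ′_n/K_d)` (values of `y ↦ y^{2g(d)}` lie in `ker(Pic(𝒪₂) → Cl) = {1, κ}`) which
(i) factors through the bit vector `x_d` (bits `0` ⟹ trivial on `L_d(i)` ⟹ `ρ_d(g)` a square ⟹ `χ = 0`), (ii) kills every `φ_j`
(`ρ_d(φ_j)² = 1`), whose bit vectors are the ROWS of `N_d` (Euler + `φ_j ∈ Gal(ℍ′_n/K_d)`), and (iii) `x_d` is onto `𝔽₂^m` (`…MoverCoordinates`);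
so `χ = δ ∘ x_d` with `δ` additive killing the rows.  If `#ker N_d = 2` (⟺ ty2's count `#{e : RM(−4d)ᵀe = 0, e₂ = 0} = 2` ⟺ a mover of
`Z(d)` exists, by `…MoverKerCount` + p681123), `δ ∈ {0, λ·}` with `ker N_d = {0, λ}` and `δ ≠ 0`; else `χ = 0 = kerSum N_d`.
BSD is not proved by any of this; no class is closed by this file.

References: [cite: TianYuanZhang2017, §3.1 (p0011 L1–L13, L53–L64), Prop. 3.2 (1), Thm. 3.6 (1), proof of Lemma 3.21 (p0020 L50–L63)];
[cite: Cox2013, §5.C Lemma 5.19, §7.D Thm. 7.24, §9.A]; [cite: Stevenhagen1995RedeiMatrices, §2 Thm. 1]; crux notes `Lines/offtyz_v7_QForm.md`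
§2 (2a)–(2b), §11 and `Lines/offtyz_v7_TransferLayer.md` §3–§5.
-/

noncomputable section

open scoped Classical NumberField

open WeierstrassCurve WeierstrassCurve.Affine Finset Matrix Literature.NumberTheory.EllipticCurves
  Literature.NumberTheory.EllipticCurves.TianYuanZhang2017
  Literature.NumberTheory.EllipticCurves.TianYuanZhang2017.W2
  Literature.NumberTheory.EllipticCurves.HeathBrown1994
  Literature.NumberTheory.EllipticCurves.HeathBrown1994.Families
  Literature.NumberTheory.EllipticCurves.Smith2016
  Literature.NumberTheory.QuadraticFields.RingClass
  Literature.NumberTheory.QuadraticFields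
  Literature.NumberTheory.QuadraticFields.RedeiReichardt
  Summit.BirchSwinnertonDyer.Rank1Residual.P2.GenusPeriodTransferLayer
  Summit.BirchSwinnertonDyer.PrintCf2.QForm

set_option autoImplicit false

namespace Summit.BirchSwinnertonDyer.PrintCf2.MoverAssembly

variable {n : ℕ} (D : GenusPointData n)

/-! ## §1 The character `χ(g) = [ρ_d(g)^{2g(d)} = κ]` of `Gal(ℍ′_n/K_d)` -/

section Character

variable {d : ℕ} {z : APoint D.H} {Φ : Finset (D.H ≃ₐ[ℚ] D.H)} {ΓH ΓH' : Subgroup (D.H ≃ₐ[ℚ] D.H)} {σ c : D.H ≃ₐ[ℚ] D.H}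
  {ρ : D.galK d →* RingClassGroup (GenusField d) 2}

/-- **`y^{2g(d)} ∈ {1, κ}` for every `y ∈ Pic(𝒪₂)(K_d)`** (block `d ≡ 5 (mod 8)` of a square-free `n`): `π(y)² ∈ Cl²`, a group of order
`g(d) = #Cl²`, so `π(y^{2g(d)}) = 1` and `y^{2g(d)} ∈ ker π = {1, κ}`. [cite: Cox2013, §7.D Thm. 7.24 and (7.27)] [cite: TianYuanZhang2017, §1 (p0002 L78–L82: g(d) = #2Cl)] -/
theorem pow_two_mul_gK_eq_one_or (hn : Squarefree n) (hd : d ∈ n.divisors) (hd8 : d % 8 = 5)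
    (h : D.CMBlockSpec d z Φ ΓH ΓH' σ c) (hρ : D.RingClassTwoBlockSpec d ΓH ΓH' ρ) (y : RingClassGroup (GenusField d) 2) :
    y ^ (2 * gK d) = 1 ∨ y ^ (2 * gK d) = ρ ⟨σ, D.sigma_mem_galK_of_cmBlockSpec h⟩ := by
  obtain ⟨hκ1, hκcl, -⟩ := kappa_spec_of_ringClass D hd hd8 h hρ
  have hdsq : Squarefree d := hn.squarefree_of_dvd (Nat.dvd_of_mem_divisors hd)
  obtain ⟨hneg, heven, hne⟩ := discr_genusField_neg_even_ne hdsq (by omega) (by omega)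
  have hker := FourRankOne.toClassGroup_two_eq_one_iff (K := GenusField d) (finrank_genusField d) hneg heven hne hκcl hκ1
  refine (hker _).mp ?_
  -- `π(y)^{2 g(d)} = (π(y)²)^{g(d)} = 1`
  set C := ClassGroup (𝓞 (GenusField d))
  set S : Subgroup C := (powMonoidHom 2 : C →* C).range with hS
  have hmemS : ∀ x : C, x ∈ S ↔ IsSquare x := fun x => by
    rw [hS, MonoidHom.mem_range]
    constructor
    · rintro ⟨r, hr⟩; exact ⟨r, by rw [← hr, powMonoidHom_apply, sq]⟩
    · rintro ⟨r, hr⟩; exact ⟨r, by rw [powMonoidHom_apply, sq, hr]⟩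
  have hcardS : Nat.card S = gK d := by
    show Nat.card S = Nat.card {a : C // IsSquare a}
    exact Nat.card_congr (Equiv.subtypeEquivRight fun x => hmemS x)
  have hsq : (toClassGroup (GenusField d) 2 y) ^ 2 ∈ S := (hmemS _).mpr ⟨_, sq _⟩
  have hpow : ((⟨_, hsq⟩ : S) : C) ^ Nat.card S = 1 := by
    rw [← Subgroup.coe_pow, pow_card_eq_one', Subgroup.coe_one]
  rw [map_pow, pow_mul, ← hcardS]
  exact hpow

/-- **`(g*g)^{g(d)}·σ⁻¹ ∈ Gal(ℍ′_n/H′_d) ⟺ ρ_d(g)^{2g(d)} = κ`** for `g ∈ Gal(ℍ′_n/K_d)` (through (RC1): `ker ρ_d = Gal(ℍ′_n/H′_d)`).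
[cite: TianYuanZhang2017, Prop. 3.2 (1) (p0010 L108–L109)] [cite: Cox2013, §9.A (pp. 180–181)] -/
theorem pow_mul_sigma_inv_mem_iff (h : D.CMBlockSpec d z Φ ΓH ΓH' σ c) (hρ : D.RingClassTwoBlockSpec d ΓH ΓH' ρ) (g : D.galK d) :
    ((g : D.H ≃ₐ[ℚ] D.H) * g) ^ gK d * σ⁻¹ ∈ ΓH' ↔ ρ g ^ (2 * gK d) = ρ ⟨σ, D.sigma_mem_galK_of_cmBlockSpec h⟩ := by
  have e : ((g : D.H ≃ₐ[ℚ] D.H) * g) ^ gK d * σ⁻¹ =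
      (((g * g) ^ gK d * ⟨σ, D.sigma_mem_galK_of_cmBlockSpec h⟩⁻¹ : D.galK d) : D.H ≃ₐ[ℚ] D.H) := by
    simp only [Subgroup.coe_mul, Subgroup.coe_pow, Subgroup.coe_inv]
  rw [e, ← hρ.2.1, map_mul, map_inv, map_pow, map_mul, ← sq, ← pow_mul, mul_inv_eq_one]

/-- In `{1, κ}` with `κ ≠ 1`, `κ² = 1`: `[ab = κ] = [a = κ] + [b = κ]`. [folklore] -/
theorem ite_eq_kappa_of_eq_mul {G : Type*} [CommGroup G] {κ a b c : G} (hκ1 : κ ≠ 1)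
    (ha : a = 1 ∨ a = κ) (hb : b = 1 ∨ b = κ) (hc : c = a * b) :
    (if c = κ then (1 : ZMod 2) else 0) = (if a = κ then (1 : ZMod 2) else 0) + (if b = κ then (1 : ZMod 2) else 0) := by
  subst hc
  have hκκ : κ * κ ≠ κ := fun h => hκ1 (mul_left_cancel (h.trans (mul_one κ).symm))
  have h1κ : (1 : G) ≠ κ := hκ1.symm
  rcases ha with rfl | rfl <;> rcases hb with rfl | rfl
  · simp [h1κ]
  · simp [h1κ]
  · simp [h1κ]
  · simp [hκκ]; decide

/-- **`χ` is additive**: `χ(gh) = χ(g) + χ(h)` on `Gal(ℍ′_n/K_d)`, `χ(g) := [(g*g)^{g(d)}σ⁻¹ ∈ Gal(ℍ′_n/H′_d)]`.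
[cite: TianYuanZhang2017, Prop. 3.2 (1), §3.1 (p0011 L1–L13: Cl′_n = Gal(H′_n/K_n) abelian)] [cite: Cox2013, §9.A] -/
theorem chi_mul (hn : Squarefree n) (hd : d ∈ n.divisors) (hd8 : d % 8 = 5)
    (h : D.CMBlockSpec d z Φ ΓH ΓH' σ c) (hρ : D.RingClassTwoBlockSpec d ΓH ΓH' ρ) (g g' : D.galK d) :
    (if (((g * g' : D.galK d) : D.H ≃ₐ[ℚ] D.H) * (g * g' : D.galK d)) ^ gK d * σ⁻¹ ∈ ΓH' then (1 : ZMod 2) else 0) =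
      (if ((g : D.H ≃ₐ[ℚ] D.H) * g) ^ gK d * σ⁻¹ ∈ ΓH' then (1 : ZMod 2) else 0) +
        (if ((g' : D.H ≃ₐ[ℚ] D.H) * g') ^ gK d * σ⁻¹ ∈ ΓH' then (1 : ZMod 2) else 0) := by
  obtain ⟨hκ1, -, -⟩ := kappa_spec_of_ringClass D hd hd8 h hρ
  have key := ite_eq_kappa_of_eq_mul hκ1 (pow_two_mul_gK_eq_one_or D hn hd hd8 h hρ (ρ g))
    (pow_two_mul_gK_eq_one_or D hn hd hd8 h hρ (ρ g')) (c := ρ (g * g') ^ (2 * gK d))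
    (by rw [map_mul]; exact mul_pow (ρ g) (ρ g') (2 * gK d))
  simp only [pow_mul_sigma_inv_mem_iff D h hρ]
  convert key using 3

/-- **`χ` vanishes on squares of `Pic(𝒪₂)`**: if `ρ_d(g)` is a square then `(g*g)^{g(d)}σ⁻¹ ∉ Gal(ℍ′_n/H′_d)`.
[cite: TianYuanZhang2017, proof of Lemma 3.21 (p0020 L55–L62)] [cite: Cox2013, §9.A] -/
theorem chi_eq_zero_of_isSquare (hn : Squarefree n) (hd : d ∈ n.divisors) (hd8 : d % 8 = 5)
    (h : D.CMBlockSpec d z Φ ΓH ΓH' σ c) (hρ : D.RingClassTwoBlockSpec d ΓH ΓH' ρ) (g : D.galK d) (hsq : IsSquare (ρ g)) :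
    ¬ (((g : D.H ≃ₐ[ℚ] D.H) * g) ^ gK d * σ⁻¹ ∈ ΓH') := by
  obtain ⟨hκ1, -, hκ2⟩ := kappa_spec_of_ringClass D hd hd8 h hρ
  rw [pow_mul_sigma_inv_mem_iff D h hρ]
  obtain ⟨y, hy⟩ := hsq
  rw [hy, ← sq, ← pow_mul, mul_comm 2 (2 * gK d), pow_mul]
  rcases pow_two_mul_gK_eq_one_or D hn hd hd8 h hρ y with h1 | h1 <;> rw [h1]
  · rw [one_pow]; exact hκ1.symm
  · rw [hκ2]; exact hκ1.symm

/-- **`χ(φ) = 0` for an involution**: if `φ*φ ∈ Gal(ℍ′_n/H′_d)` then `(φ*φ)^{g(d)}σ⁻¹ ∉ Gal(ℍ′_n/H′_d)` (`ρ(φ)^{2g(d)} = 1 ≠ κ`).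
[cite: TianYuanZhang2017, Prop. 3.2 (1)] [cite: Cox2013, §9.A] -/
theorem chi_eq_zero_of_mul_self_mem (hd : d ∈ n.divisors) (hd8 : d % 8 = 5)
    (h : D.CMBlockSpec d z Φ ΓH ΓH' σ c) (hρ : D.RingClassTwoBlockSpec d ΓH ΓH' ρ) (φ : D.galK d)
    (hφ : (φ : D.H ≃ₐ[ℚ] D.H) * φ ∈ ΓH') : ¬ (((φ : D.H ≃ₐ[ℚ] D.H) * φ) ^ gK d * σ⁻¹ ∈ ΓH') := by
  obtain ⟨hκ1, -, -⟩ := kappa_spec_of_ringClass D hd hd8 h hρ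
  rw [pow_mul_sigma_inv_mem_iff D h hρ, pow_mul, sq, ← map_mul,
    (hρ.2.1 (φ * φ)).mpr (by simpa only [Subgroup.coe_mul] using hφ), one_pow]
  exact hκ1.symm

end Character

/-! ## §2 Frobenius rows -/

variable {m : ℕ} (q : Fin m → ℕ) (hq : ∀ j, (q j).Prime) (hqodd : ∀ j, Odd (q j)) (hqinj : Function.Injective q)

/-- A symbol `±1` acting by `zsmul` moves a non-zero element iff it is `−1`: the bit `[J•a ≠ a]` is Monsky's additive symbol. [folklore] -/
theorem bit_zsmul_eq_addLegendreSym {F : Type*} [Field F] [CharZero F] {a : F} (ha0 : a ≠ 0) {A : ℤ} {b : ℕ}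
    (hJ : jacobiSym A b = 1 ∨ jacobiSym A b = -1) :
    (if (jacobiSym A b) • a = a then (0 : ZMod 2) else 1) = addLegendreSym A b := by
  rcases hJ with hJ | hJ
  · rw [hJ, one_zsmul, if_pos rfl, addLegendreSym_of_eq_one hJ]
  · rw [hJ, neg_one_zsmul, if_neg (fun h => ha0 (eq_zero_of_eq_neg' h.symm)), addLegendreSym_of_eq_neg_one hJ]

include hq hqinj in
/-- **The bit vector of a Frobenius element `φ_j` is the `j`-th ROW of the real Rédei matrix `N_d = A_d + D₋₁`.**  From Euler's criterion
(`φ_j(i) = (−1/q_j)·i`, `φ_j(√−q_i) = (−q_i/q_j)·√−q_i`, `i ≠ j`): `[φ_j moves i√−q_i] = (q_i/q_j)₊ = A_{ji}`; and from `φ_j(√−d) = √−d`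
(the block relation): `[φ_j moves i√−q_j] = (−1/q_j)₊ + Σ_{i≠j} A_{ji} = N_{jj}`. [cite: TianYuanZhang2017, §3.1 (p0011 L60–L64)]
[cite: Cox2013, §5.C Lemma 5.19 (the Artin symbol induces the Frobenius)] [cite: HeathBrown1994SelmerCongruentII, Appendix (Monsky), typescript p. 39 L13–L26] -/
theorem bits_eq_row_of_frobenius {d : ℕ} (hd : d ∈ n.divisors) (hprod : ∏ j, q j = d) (j : Fin m) {φ : D.H ≃ₐ[ℚ] D.H}
    (hφd : φ (D.sqrtNeg d) = D.sqrtNeg d) (hφi : φ D.im = (jacobiSym (-1) (q j)) • D.im)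
    (hφq : ∀ i, i ≠ j → φ (D.sqrtNeg (q i)) = (jacobiSym (-(q i : ℤ)) (q j)) • D.sqrtNeg (q i)) (i : Fin m) :
    (if φ (D.im * D.sqrtNeg (q i)) = D.im * D.sqrtNeg (q i) then (0 : ZMod 2) else 1) =
      (legendreMatrix q + legendreDiagonal q (-1)) j i := by
  have hqn : ∀ i, q i ∈ n.divisors := mem_divisors_of_block q hd hprod
  have hJi : jacobiSym (-1) (q j) = 1 ∨ jacobiSym (-1) (q j) = -1 :=
    jacobiSym_eq_one_or_neg_one_of_prime (hq j) (by
      rw [Int.cast_neg, Int.cast_one, neg_ne_zero]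
      haveI : Fact (1 < q j) := ⟨(hq j).one_lt⟩
      exact one_ne_zero)
  -- off-diagonal bits
  have hoff : ∀ i, i ≠ j → (if φ (D.im * D.sqrtNeg (q i)) = D.im * D.sqrtNeg (q i) then (0 : ZMod 2) else 1) = legendreMatrix q j i := by
    intro i hij
    have hq0 : ((q i : ℤ) : ZMod (q j)) ≠ 0 := by
      rw [Int.cast_natCast]; exact natCast_zmod_ne_zero_of_prime_ne (hq j) (hq i) fun h => hij (hqinj h)
    have hJq : jacobiSym (q i : ℤ) (q j) = 1 ∨ jacobiSym (q i : ℤ) (q j) = -1 := jacobiSym_eq_one_or_neg_one_of_prime (hq j) hq0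
    have hmul : φ (D.im * D.sqrtNeg (q i)) = (jacobiSym (q i : ℤ) (q j)) • (D.im * D.sqrtNeg (q i)) := by
      rw [map_mul, hφi, hφq i hij, smul_mul_smul_comm, ← jacobiSym.mul_left, show (-1 : ℤ) * -(q i : ℤ) = q i by ring]
    rw [hmul, bit_zsmul_eq_addLegendreSym (im_mul_sqrtNeg_ne_zero D (hqn i)) hJq, legendreMatrix_apply_of_ne q (Ne.symm hij)]
  by_cases hij : i = j
  · subst hij
    -- the diagonal bit from the block relation `[φ moves √−d] = [φ moves i] + Σ_i [φ moves i√−q_i]`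
    have hrel := bit_sqrtNeg_eq_bit_im_add_sum D q hd hprod φ
    rw [if_pos hφd, ← Finset.add_sum_erase _ _ (mem_univ i),
      Finset.sum_congr rfl (fun l hl => hoff l (ne_of_mem_erase hl))] at hrel
    rw [Matrix.add_apply, legendreMatrix_apply_self]
    unfold legendreDiagonal
    rw [diagonal_apply_eq, hφi, bit_zsmul_eq_addLegendreSym D.im_ne_zero hJi] at *
    -- solve `0 = c + (b + s)` for `b`
    have e : ∀ c b s : ZMod 2, 0 = c + (b + s) → b = s + c := by decide
    exact e _ _ _ hrel
  · rw [hoff i hij, Matrix.add_apply]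
    unfold legendreDiagonal
    rw [diagonal_apply_ne _ (Ne.symm hij), add_zero]

/-! ## §3 The block form -/

include hq hqodd hqinj in
/-- **`#ker N_d = 2 ⟺ Z(d) has a mover trivial on L_d(i)`** (displayed block `d = ∏ q ≡ 5 (mod 8)`): ty2's
`exists_mover_iff_card_redeiKernel_two_eq_two` for the tuple `(2; q)` read through `card_redeiKernelTwo_eq_card_ker_realRedei`.
[cite: Stevenhagen1995RedeiMatrices, §2 Thm. 1] [cite: TianYuanZhang2017, Prop. 3.2 (1), proof of Lemma 3.21 (p0020 L55–L62)] -/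
theorem exists_mover_iff_card_ker_realRedei_eq_two (hn : Squarefree n) {d : ℕ} (hd : d ∈ n.divisors) (hd8 : d % 8 = 5)
    (hprod : ∏ j, q j = d)
    {z : APoint D.H} {Φ : Finset (D.H ≃ₐ[ℚ] D.H)} {ΓH ΓH' : Subgroup (D.H ≃ₐ[ℚ] D.H)} {σ c : D.H ≃ₐ[ℚ] D.H}
    (h : D.CMBlockSpec d z Φ ΓH ΓH' σ c) {ρ : D.galK d →* RingClassGroup (GenusField d) 2}
    (hρ : D.RingClassTwoBlockSpec d ΓH ΓH' ρ) :
    (∃ g : D.H ≃ₐ[ℚ] D.H, D.TrivialOnL d g ∧ D.galPt g (D.Z d) ≠ D.Z d) ↔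
      Fintype.card {v : Fin m → ZMod 2 // (legendreMatrix q + legendreDiagonal q (-1)) *ᵥ v = 0} = 2 := by
  have h4 : (∏ i, q i) % 4 = 1 := by rw [hprod]; omega
  rw [exists_mover_iff_card_redeiKernel_two_eq_two D hn hd hd8 h hρ (prime_cons_two q hq) (injective_cons_two q hqodd hqinj)
    (p := Fin.cons 2 q) (i₂ := 0) (by rw [prod_cons_two q h4, if_pos h4, hprod]) (Fin.cons_zero _ _),
    ← hprod, card_redeiKernelTwo_eq_card_ker_realRedei q hq hqodd hqinj h4]

include hq hqodd hqinj in
/-- **THE BLOCK FORM.**  For a displayed block `d = q₁⋯q_m ≡ 5 (mod 8)` of a square-free `n` satisfying the Frobenius hypothesis, and every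
`g ∈ Gal(ℍ′_n/K_d)`:  `[(g*g)^{g(d)}·σ⁻¹ ∈ Gal(ℍ′_n/H′_d)] = Σ_i (kerSum N_d)_i · [g moves i√−q_i]`  (`N_d = A_d + D₋₁`).
With `…MoverSquares.galPt_mul_self_Z_eq_add_ite`: `g*g·Z(d) = Z(d) + (kerSum N_d · x_d(g))·τ(1)`.
[cite: TianYuanZhang2017, §3.1 (p0011 L1–L13, L53–L64), Prop. 3.2 (1), Thm. 3.6 (1), proof of Lemma 3.21 (p0020 L50–L63)]
[cite: Cox2013, §5.C Lemma 5.19, §7.D Thm. 7.24, §9.A] [cite: Stevenhagen1995RedeiMatrices, §2 Thm. 1] -/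
theorem sqMotion_eq_kerSum_dotProduct_bits (hn : Squarefree n) {d : ℕ} (hd : d ∈ n.divisors) (hd8 : d % 8 = 5)
    (hprod : ∏ j, q j = d)
    {z : APoint D.H} {Φ : Finset (D.H ≃ₐ[ℚ] D.H)} {ΓH ΓH' : Subgroup (D.H ≃ₐ[ℚ] D.H)} {σ c : D.H ≃ₐ[ℚ] D.H}
    (h : D.CMBlockSpec d z Φ ΓH ΓH' σ c) {ρ : D.galK d →* RingClassGroup (GenusField d) 2}
    (hρ : D.RingClassTwoBlockSpec d ΓH ΓH' ρ)
    (hFrob : ∀ j : Fin m, ∃ φ : D.H ≃ₐ[ℚ] D.H, φ (D.sqrtNeg d) = D.sqrtNeg d ∧ φ * φ ∈ ΓH' ∧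
      φ D.im = (jacobiSym (-1) (q j)) • D.im ∧
      ∀ i, i ≠ j → φ (D.sqrtNeg (q i)) = (jacobiSym (-(q i : ℤ)) (q j)) • D.sqrtNeg (q i))
    (g : D.H ≃ₐ[ℚ] D.H) (hg : g (D.sqrtNeg d) = D.sqrtNeg d) :
    (if (g * g) ^ gK d * σ⁻¹ ∈ ΓH' then (1 : ZMod 2) else 0) =
      ∑ i, kerSum (legendreMatrix q + legendreDiagonal q (-1)) i *
        (if g (D.im * D.sqrtNeg (q i)) = D.im * D.sqrtNeg (q i) then (0 : ZMod 2) else 1) := by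
  have hd1 : 1 < d := by omega
  have hqn : ∀ i, q i ∈ n.divisors := mem_divisors_of_block q hd hprod
  have hq1 : ∀ j, 1 < q j := fun j => (hq j).one_lt
  set N := legendreMatrix q + legendreDiagonal q (-1) with hN
  -- the two functions on `Gal(ℍ′_n/K_d)`
  set χ : D.galK d → ZMod 2 := fun a => if ((a : D.H ≃ₐ[ℚ] D.H) * a) ^ gK d * σ⁻¹ ∈ ΓH' then 1 else 0 with hχ
  set x : D.galK d → (Fin m → ZMod 2) := fun a i =>
    if (a : D.H ≃ₐ[ℚ] D.H) (D.im * D.sqrtNeg (q i)) = D.im * D.sqrtNeg (q i) then 0 else 1 with hx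
  have hχmul : ∀ a b, χ (a * b) = χ a + χ b := fun a b => chi_mul D hn hd hd8 h hρ a b
  have hxmul : ∀ a b, x (a * b) = x a + x b := by
    intro a b; funext i
    exact bit_comp ((a : D.H ≃ₐ[ℚ] D.H) : D.H →+* D.H) ((b : D.H ≃ₐ[ℚ] D.H) : D.H →+* D.H)
      (apply_im_mul_sqrtNeg_eq_or D _ (hqn i)) (apply_im_mul_sqrtNeg_eq_or D _ (hqn i)) (im_mul_sqrtNeg_ne_zero D (hqn i))
  -- (i) `χ` factors through `x`
  have hχx0 : ∀ a, x a = 0 → χ a = 0 := by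
    intro a ha
    have hbits : ∀ i, (a : D.H ≃ₐ[ℚ] D.H) (D.im * D.sqrtNeg (q i)) = D.im * D.sqrtNeg (q i) := by
      intro i; have := congr_fun ha i; by_contra hne
      simp only [hx, if_neg hne, Pi.zero_apply] at this; exact one_ne_zero this
    have hL : D.TrivialOnL d a := trivialOnL_of_bits_eq_zero D q hq hqinj hn hd hprod a.2 hbits
    have hsq : IsSquare (ρ a) := (hρ.2.2.2 a).mp hL
    simp only [hχ, if_neg (chi_eq_zero_of_isSquare D hn hd hd8 h hρ a hsq)]
  have hχx : ∀ a b, x a = x b → χ a = χ b := by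
    intro a b hab
    have h0 : x (a⁻¹ * b) = 0 := by
      have e := hxmul a (a⁻¹ * b)
      rw [mul_inv_cancel_left, ← hab] at e
      -- `x b... `: from `x a = x a + x(a⁻¹ b)` get `x (a⁻¹ b) = 0`
      have : x a + x (a⁻¹ * b) = x a + 0 := by rw [add_zero]; exact e.symm
      exact add_left_cancel this
    have e := hχmul a (a⁻¹ * b)
    rw [mul_inv_cancel_left, hχx0 _ h0, add_zero] at e
    exact e.symm
  -- (iii) `x` is onto: the induced additive map `δ`
  have hsurj : ∀ v : Fin m → ZMod 2, ∃ a : D.galK d, x a = v := by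
    intro v
    obtain ⟨a, ha, hav⟩ := exists_mem_galK_bits_eq D q hq hqodd hqinj hn hd hd8 hprod h hρ v
    exact ⟨⟨a, ha⟩, funext hav⟩
  choose lift hlift using hsurj
  let δ : (Fin m → ZMod 2) →+ ZMod 2 :=
    { toFun := fun v => χ (lift v)
      map_zero' := by
        show χ (lift 0) = 0
        rw [hχx (lift 0) 1 (by rw [hlift]; funext i; simp only [hx, Pi.zero_apply]; exact (if_pos rfl).symm)]
        simp only [hχ]
        rw [if_neg]
        have hsq1 : IsSquare (ρ 1) := ⟨1, by rw [map_one]; exact (mul_one (1 : RingClassGroup (GenusField d) 2)).symm⟩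
        exact chi_eq_zero_of_isSquare D hn hd hd8 h hρ 1 hsq1
      map_add' := fun v w => by
        show χ (lift (v + w)) = χ (lift v) + χ (lift w)
        rw [← hχmul, hχx (lift (v + w)) (lift v * lift w) (by rw [hxmul, hlift, hlift, hlift])] }
  have hδ : ∀ a, χ a = δ (x a) := fun a => hχx a (lift (x a)) (by rw [hlift])
  -- (ii) `δ` kills the rows of `N`
  have hrows : ∀ j, δ (N j) = 0 := by
    intro j
    obtain ⟨φ, hφd, hφφ, hφi, hφq⟩ := hFrob j
    have hxφ : x ⟨φ, hφd⟩ = N j := funext fun i => bits_eq_row_of_frobenius D q hq hqinj hd hprod j hφd hφi hφq i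
    rw [← hxφ, ← hδ]
    simp only [hχ]
    rw [if_neg (chi_eq_zero_of_mul_self_mem D hd hd8 h hρ ⟨φ, hφd⟩ hφφ)]
  -- the goal is `χ ⟨g, hg⟩ = kerSum N ⬝ x ⟨g, hg⟩`
  change χ ⟨g, hg⟩ = ∑ i, kerSum N i * x ⟨g, hg⟩ i
  by_cases hcard : Fintype.card {v : Fin m → ZMod 2 // N *ᵥ v = 0} = 2
  · -- a mover exists: `χ ≢ 0`
    obtain ⟨hl0, hker⟩ := ker_iff_of_card_eq_two N hcard
    rcases addMonoidHom_eq_zero_or_eq_dotProduct N hker δ hrows with hzero | hdot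
    · exfalso
      obtain ⟨t, htL, htne⟩ := (exists_mover_iff_card_ker_realRedei_eq_two D q hq hqodd hqinj hn hd hd8 hprod h hρ).mpr hcard
      -- `t ≡ a*a (mod ΓH')` for some `a ∈ Gal(ℍ′_n/K_d)`; then `χ a = 1`
      have htK : t ∈ D.galK d := D.mem_galK_of_trivialOnL hd1 htL
      obtain ⟨y, hy⟩ := (hρ.2.2.2 ⟨t, htK⟩).mp htL
      obtain ⟨a, rfl⟩ := hρ.1 y
      have hmem : (⟨t, htK⟩ : D.galK d)⁻¹ * (a * a) ∈ ρ.ker := by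
        rw [MonoidHom.mem_ker, map_mul, map_inv, map_mul, hy, inv_mul_cancel]
      have hΓ' : ((⟨t, htK⟩ : D.galK d)⁻¹ * (a * a) : D.galK d).1 ∈ ΓH' := (hρ.2.1 _).mp (MonoidHom.mem_ker.mp hmem)
      have hmove : D.galPt ((a : D.H ≃ₐ[ℚ] D.H) * a) (D.Z d) ≠ D.Z d := by
        have e : (a : D.H ≃ₐ[ℚ] D.H) * a = t * (t⁻¹ * ((a : D.H ≃ₐ[ℚ] D.H) * a)) := by group
        rw [e, galPt_mul, galPt_Z_eq_of_mem D h (by simpa only [Subgroup.coe_mul, Subgroup.coe_inv] using hΓ')]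
        exact htne
      have hχa : χ a = 1 := by
        simp only [hχ]
        rw [if_pos ((galPt_genusPeriod_ne_iff_of_cmBlockSpec D hd hd8 h
          (trivialOnL_mul_self_of_mem_divisors D (a : D.H ≃ₐ[ℚ] D.H) hd)).1.mp hmove)]
      rw [hδ, hzero] at hχa
      exact zero_ne_one hχa
    · rw [hδ, hdot, dotProduct]
  · -- no mover: both sides vanish
    rw [kerSum_eq_zero_of_card_ne_two N hcard]
    simp only [Pi.zero_apply, zero_mul, Finset.sum_const_zero]
    simp only [hχ]
    rw [if_neg]
    intro hmem
    apply hcard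
    refine (exists_mover_iff_card_ker_realRedei_eq_two D q hq hqodd hqinj hn hd hd8 hprod h hρ).mp ⟨g * g, ?_, ?_⟩
    · exact trivialOnL_mul_self_of_mem_divisors D g hd
    · exact ((galPt_genusPeriod_ne_iff_of_cmBlockSpec D hd hd8 h (trivialOnL_mul_self_of_mem_divisors D g hd)).1).mpr hmem

end Summit.BirchSwinnertonDyer.PrintCf2.MoverAssembly

end
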